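import Summits.QuantumFields.YangMills.Theorems.UnitScaleTiltProp7TorusGreenGradientDecay
import Summits.QuantumFields.YangMills.Theorems.UnitScaleTiltProp7CentreHarmonicInterpolantFlat
import HarnessLib

/-!
# Route `UnitScaleTilt`, crux K1 «MinimiserStabilityRegPr» (stmt-QuantumFields-19200), route-R E′ path (α′), residue (hK), step (A0): THE DICTIONARY between B5's torus Laplace inverse
# `LapSinv N 1` (carrier `Tor N`, ✓ `B5LaplaceInverse`, used by ✓ `…CentreHarmonicDivFlat`∕`…InterpolantFlat`) and the probabilists' zero-mode-removed torus Green function `torusGreen`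
# (carrier `TorusSite d L`, ✓ `LatticeGreenFunction`, whose d = 3 gradient decay is ✓ `…TorusGreenGradientDecay`): for the constant family `N = fun _ => L`,
# `Tor N = TorusSite d L`, `chi N = torusChar`, `lsym N 1 p = 2ε(p_k)`, and `(Δ⁻¹)(x,z) = ½·G̃_L(x − z)` (real)

Cell `ym3-torus`, D-0154 (3c) twin-width seat `ym-routeR-w3` (gen 5); ★p1 g14 standing PASS-at-dry-run 18:44:59Z; LOCATE 19200 evidence #53 §8 (A0).  THEOREMS ONLY (0 `def`, 0 `sorry`);
`--supports stmt-QuantumFields-19200`, count-neutral.  YM₃ on T³ is a ladder rung (R3), not the Clay problem; nothing here claims the stub, the crux, d = 4 or the gap.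

WHAT IS PROVED (ns `…Theorems.Prop7TorusGreenDictionary`; any `d`, `L ≥ 1`; `N := fun _ : Fin d => L`).
* §1 `chi_const_eq_torusChar` (rfl), `normSq_stdAddChar` (`|e(a)|² = 1`), `norm_stdAddChar_sub_one_sq'` (`‖e(κ) − 1‖² = 2(1 − cos(2πκ∕L))`), ★ `lsym_one_eq_two_dispersion`
  (`lsym N 1 p = 2·ε(p_p)`), `linv_one_eq` (`linv N 1 p = if p = 0 then 0 else (2ε)⁻¹`, real), `linv_one_neg`, `chi_neg_left'`.
* §2 ★★ `LapSinv_one_apply` — `(Δ⁻¹)(x,z) = L^{−d}·Σ_p linv(p)·χ_p(x − z)`; `LapSinv_one_apply_im` (`= 0`, by `p ↦ −p`); ★★★ `LapSinv_one_apply_eq_half_torusGreen` —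
  `LapSinv (fun _ => L) 1 x z = ((torusGreen (x − z) ∕ 2 : ℝ) : ℂ)`.
HONEST SCOPE.  Convention bookkeeping; with it ✓ `torusGreen_grad_mul_dist_sq_le` reads as the pointwise row `|Δ⁻¹(x+eᵢ,z) − Δ⁻¹(x,z)|·dist(x,z)² ≤ C∕2` for B5's `Δ⁻¹` at `c = 1` on
`Tor (fun _ => L)` (and at `c = n`: `LapSinv N n = n⁻²·LapSinv N 1`, px17's ✓ `LapS_natCast_mulVec` letters).

References: T. Bałaban, CMP 95 (1984) 17–40 [Balaban1984PropagatorsI] (Sect. C p.22, (1.29) p.23); S. Friedli, Y. Velenik, *Statistical Mechanics of Lattice Systems*, CUP 2017, §8.4,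
§10.4 [FriedliVelenik2017]; G. F. Lawler, V. Limic, *Random Walk: A Modern Introduction*, CUP 2010, Ch. 4 [LawlerLimic2010].
-/

set_option autoImplicit false

noncomputable section

open scoped BigOperators Matrix ComplexConjugate Real
open Finset Complex Matrix

namespace Summit.QuantumFields.YangMills.Theorems.Prop7TorusGreenDictionary

open Literature.MathematicalPhysics.QuantumFieldTheory.Balaban1983to89
open B5Prop11Plancherel B5Block118 B5LaplaceInverse B5Momentum130 B5Momentum133
open Literature.Probability.LatticeModels

variable {d L : ℕ} [NeZero L]

/-! ## §1 Characters and symbols -/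

/-- B5's character IS the probabilists' character for the constant family. [folklore] -/
theorem chi_const_eq_torusChar (p x : TorusSite d L) : chi (fun _ : Fin d => L) p x = torusChar p x := rfl

/-- `|e(a)|² = 1` for the standard additive character of `ℤ/Lℤ`. [folklore] -/
theorem normSq_stdAddChar (a : ZMod L) : conj ((ZMod.stdAddChar (N := L)) a : ℂ) * (ZMod.stdAddChar (N := L)) a = 1 := by
  rw [conj_stdAddChar, ← AddChar.map_add_eq_mul, neg_add_cancel, AddChar.map_zero_eq_one]

/-- `‖e(κ) − 1‖²` as a complex number: `conj(e−1)(e−1) = 2(1 − cos(2πκ∕L))`. [folklore] -/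
theorem conj_mul_stdAddChar_sub_one (κ : ZMod L) :
    conj (((ZMod.stdAddChar (N := L)) κ : ℂ) - 1) * (((ZMod.stdAddChar (N := L)) κ : ℂ) - 1)
      = ((2 * (1 - Real.cos (2 * π * (κ.val : ℝ) / L)) : ℝ) : ℂ) := by
  have h1 := normSq_stdAddChar κ
  have hre := re_stdAddChar κ
  -- `conj(e-1)(e-1) = conj e * e - e - conj e + 1 = 2 - 2 Re e`
  have e1 : conj (((ZMod.stdAddChar (N := L)) κ : ℂ) - 1) * (((ZMod.stdAddChar (N := L)) κ : ℂ) - 1)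
      = conj ((ZMod.stdAddChar (N := L)) κ : ℂ) * (ZMod.stdAddChar (N := L)) κ - ((ZMod.stdAddChar (N := L)) κ + conj ((ZMod.stdAddChar (N := L)) κ : ℂ)) + 1 := by
    rw [map_sub, map_one]; ring
  rw [e1, h1, Complex.add_conj, ← hre]
  push_cast
  ring

/-- ★ **`lsym N 1 p = 2·ε(p_p)`**: B5's Laplace symbol at unit lattice factor is twice the probabilists' dispersion at the lattice momentum. [folklore] -/
theorem lsym_one_eq_two_dispersion (p : TorusSite d L) :
    lsym (fun _ : Fin d => L) (1 : ℂ) p = ((2 * dispersion (latticeMomentum L p) : ℝ) : ℂ) := by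
  simp only [lsym, ssym, one_mul]
  rw [dispersion, Finset.mul_sum]
  push_cast
  refine Finset.sum_congr rfl fun ν _ => ?_
  rw [conj_mul_stdAddChar_sub_one, latticeMomentum]
  push_cast
  ring

/-- `linv N 1 p`: `0` at `p = 0`, `(2ε(p))⁻¹` otherwise. [folklore] -/
theorem linv_one_eq (p : TorusSite d L) :
    linv (fun _ : Fin d => L) (1 : ℂ) p = if p = 0 then 0 else (((2 * dispersion (latticeMomentum L p))⁻¹ : ℝ) : ℂ) := by
  rw [linv_eq_inv, lsym_one_eq_two_dispersion]
  split_ifs with hp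
  · subst hp
    have : dispersion (latticeMomentum L (0 : TorusSite d L)) = 0 := by
      simp [dispersion, latticeMomentum]
    rw [this]; simp
  · push_cast; ring

/-- `χ_{−p}(x) = conj χ_p(x)`. [folklore] -/
theorem chi_neg_left' (p x : TorusSite d L) : chi (fun _ : Fin d => L) (-p) x = conj (chi (fun _ : Fin d => L) p x) :=
  (conj_chi _ p x).symm

/-- `ε(p_{−k}) = ε(p_k)` (through `lsym`, which is conjugation invariant). [folklore] -/
theorem dispersion_latticeMomentum_neg (p : TorusSite d L) :
    dispersion (latticeMomentum L (-p)) = dispersion (latticeMomentum L p) := by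
  have h : lsym (fun _ : Fin d => L) (1 : ℂ) (-p) = lsym (fun _ : Fin d => L) (1 : ℂ) p := by
    simp only [lsym, ssym, one_mul, Pi.neg_apply]
    refine Finset.sum_congr rfl fun ν _ => ?_
    rw [← conj_stdAddChar]
    have e : conj ((ZMod.stdAddChar (N := L)) (p ν) : ℂ) - 1 = conj (((ZMod.stdAddChar (N := L)) (p ν) : ℂ) - 1) := by rw [map_sub, map_one]
    rw [e, Complex.conj_conj, mul_comm]
  rw [lsym_one_eq_two_dispersion, lsym_one_eq_two_dispersion] at h
  have := Complex.ofReal_injective h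
  linarith

/-! ## §2 The inverse Laplacian entries -/

/-- ★★ **`(Δ⁻¹)(x,z) = L^{−d}·Σ_p linv(p)·χ_p(x − z)`** for the constant family at `c = 1` (unitary DFT `F_{p,x} = L^{−d∕2}conj χ_p(x)`). [cite: Balaban1984PropagatorsI, Sect. C p.22] -/
theorem LapSinv_one_apply (x z : TorusSite d L) :
    LapSinv (fun _ : Fin d => L) (1 : ℂ) x z
      = ((((L : ℝ) ^ d)⁻¹ : ℝ) : ℂ) * ∑ p : TorusSite d L, linv (fun _ : Fin d => L) (1 : ℂ) p * chi (fun _ : Fin d => L) p (x - z) := by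
  have hcard : (Fintype.card (Tor (fun _ : Fin d => L)) : ℝ) = (L : ℝ) ^ d := by
    rw [show Fintype.card (Tor (fun _ : Fin d => L)) = Fintype.card (Fin d → ZMod L) from rfl, Fintype.card_fun, ZMod.card, Fintype.card_fin]
    push_cast; ring
  have hcT : ((cT (fun _ : Fin d => L) : ℂ)) * (cT (fun _ : Fin d => L) : ℂ) = ((((L : ℝ) ^ d)⁻¹ : ℝ) : ℂ) := by
    rw [← Complex.ofReal_mul]
    congr 1
    unfold cT
    rw [hcard, ← mul_inv, Real.mul_self_sqrt (by positivity)]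
  unfold LapSinv
  rw [Matrix.mul_apply]
  simp only [Matrix.mul_diagonal, Matrix.conjTranspose_apply, Complex.star_def, conj_dft]
  rw [Finset.mul_sum]
  refine Finset.sum_congr rfl fun p _ => ?_
  rw [dft_apply', sub_eq_add_neg, chi_add_right]
  have hneg : chi (fun _ : Fin d => L) p (-z) = conj (chi (fun _ : Fin d => L) p z) := by
    rw [conj_chi]
    unfold chi
    refine Finset.prod_congr rfl fun μ _ => ?_
    congr 1
    simp only [Pi.neg_apply]; ring
  rw [hneg, ← hcT]
  ring

/-- the entry is REAL: its imaginary part vanishes (`p ↦ −p` conjugates each term). [folklore] -/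
theorem LapSinv_one_apply_im (x z : TorusSite d L) : (LapSinv (fun _ : Fin d => L) (1 : ℂ) x z).im = 0 := by
  rw [LapSinv_one_apply]
  set S : ℂ := ∑ p : TorusSite d L, linv (fun _ : Fin d => L) (1 : ℂ) p * chi (fun _ : Fin d => L) p (x - z) with hS
  have hconj : conj S = S := by
    rw [hS, map_sum]
    rw [← Equiv.sum_comp (Equiv.neg (TorusSite d L)) (fun p => linv (fun _ : Fin d => L) (1 : ℂ) p * chi (fun _ : Fin d => L) p (x - z))]
    refine Finset.sum_congr rfl fun p _ => ?_
    simp only [Equiv.neg_apply, map_mul]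
    rw [chi_neg_left', linv_one_eq, linv_one_eq]
    by_cases hp : p = 0
    · subst hp; simp
    · have hnp : -p ≠ 0 := fun h => hp (neg_eq_zero.mp h)
      rw [if_neg hp, if_neg hnp, dispersion_latticeMomentum_neg, Complex.conj_ofReal]
  have hSreal : S.im = 0 := by
    have := congrArg Complex.im hconj
    rw [Complex.conj_im] at this
    linarith
  rw [Complex.mul_im, Complex.ofReal_re, Complex.ofReal_im, hSreal]
  ring

/-- ★★★ **THE DICTIONARY**: `LapSinv (fun _ => L) 1 x z = ½·torusGreen (x − z)` — B5's zero-mode-free inverse Laplacian at unit lattice factor is half the probabilists' torus Green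
function (whose `ε = Σ(1 − cos)` is half of B5's `Σ|e^{ip} − 1|²`). [cite: Balaban1984PropagatorsI, Sect. C p.22; FriedliVelenik2017, §8.4] -/
theorem LapSinv_one_apply_eq_half_torusGreen (x z : TorusSite d L) :
    LapSinv (fun _ : Fin d => L) (1 : ℂ) x z = ((torusGreen (x - z) / 2 : ℝ) : ℂ) := by
  apply Complex.ext
  · -- real parts
    rw [Complex.ofReal_re, LapSinv_one_apply, torusGreen]
    rw [Complex.re_ofReal_mul, Complex.re_sum]
    have hterm : ∀ p : TorusSite d L, (linv (fun _ : Fin d => L) (1 : ℂ) p * chi (fun _ : Fin d => L) p (x - z)).re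
        = if p = 0 then 0 else Real.cos (∑ i, latticeMomentum L p i * (((x - z) i).val : ℝ)) / dispersion (latticeMomentum L p) / 2 := by
      intro p
      rw [linv_one_eq]
      split_ifs with hp
      · simp
      · rw [Complex.re_ofReal_mul, chi_const_eq_torusChar, torusChar_re]
        have hε := dispersion_latticeMomentum_pos hp
        field_simp
    rw [Finset.sum_congr rfl fun p _ => hterm p, Finset.sum_ite, Finset.sum_const_zero, zero_add, Finset.filter_ne', ← Finset.sum_div]
    field_simp
  · rw [LapSinv_one_apply_im, Complex.ofReal_im]

end Summit.QuantumFields.YangMills.Theorems.Prop7TorusGreenDictionary
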